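import Summits.HodgeConjecture.CorCM.MultiFieldWeilDodecicHyperbolic
import HarnessLib

/-!
# MULTI-FIELD WEIL ENGINE — ONE DODECIC FIELD: every product of copies of `E` and of ONE hyperbolic CM SIXFOLD of `k`-signature `(3,3)` over a dodecic CM field through `k` whose
# `τ`-embeddings are `3`-homogeneously permuted by `Aut(ℂ/k)` — given Markman's hyperbolic-sixfold theorem and the hyperbolicity datum, NOTHING ELSE

Cell `pub-hodgecm2` (COR-CM), seat b30 gen 43 (2026-08-26); count-neutral own lane MULTI-FIELD WEIL ENGINE (stem `MultiFieldWeil*`), the one-field form of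
`CorCM/MultiFieldWeilDodecicHyperbolic.lean` (F11): when all slots lie over ONE field (`hI`; with one structure per field this means one sixfold `B`), the cross-field hypotheses of F11
(the degree-`60` pair, the outside values) are VOID and are dropped.  What remains: `[K:ℚ] = 12`, three type members over `τ`, `3`-HOMOGENEITY of `Aut(ℂ/k)` on the six
`τ`-embeddings of `K` (sextic part `𝔖₆`, `𝔄₆`, `PGL₂(5)`, …), and ONE hyperbolicity datum for `(⨁_{Fin 1} B, ι(iδ))`.  Conclusion: the Hodge conjecture for every `B^a × E^b`
(and everything dominated by one), GIVEN Markman's theorem.  Theorems only; no definition, no named fact, no `sorry`.  HONEST FRAMING: conditional on the displayed Markman binder and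
the displayed hyperbolicity datum; `HC_CM` is NOT proved and not asserted.
[cite: Markman2025SecantWeil, Thm 1.5.1 and §1.1] [cite: vanGeemen1994HodgeAV, 4.9, Lemma 5.2 (1) and 5.4] [cite: Deligne1982HodgeCycles, proof of Thm. 4.8 with Prop. 4.4; §5 (b)]
[cite: Shimura1998, §18.2 Lemma (i)] [cite: Pohlmann1968, Thm 1] [cite: MoonenZarhin1995Duke, Thm. 2.4] [cite: DixonMortimer1996, §2.1; §9.4] [cite: MumfordAV1970, §19]

## References
* [Markman2025SecantWeil] E. Markman, arXiv:2502.03415, Thm 1.5.1, §1.1 (unrefereed).  [vanGeemen1994HodgeAV] B. van Geemen, LNM 1594 (1994), 4.9, Lemma 5.2, 5.4.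
  [Deligne1982HodgeCycles] P. Deligne, LNM 900 (1982), §4–§5.  [Shimura1998] G. Shimura, *Abelian varieties with complex multiplication and modular functions*, §18.2.
  [Pohlmann1968] H. Pohlmann, Ann. of Math. 88 (1968), Thm 1.  [MoonenZarhin1995Duke] B. Moonen, Yu. Zarhin, Duke Math. J. 77 (1995), Thm. 2.4.  [DixonMortimer1996] J. D. Dixon,
  B. Mortimer, *Permutation Groups*, GTM 163, §2.1, §9.4.  [MumfordAV1970] D. Mumford, *Abelian Varieties*, §19.
-/

noncomputable section

open CategoryTheory CategoryTheory.Limits NumberField IntermediateField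

namespace Summit.HodgeConjecture.CorCM.MultiFieldWeil

open Finset
open Literature.AlgebraicGeometry Literature.AlgebraicGeometry.Motives Literature.AlgebraicGeometry.HodgeTheory
open Literature.AlgebraicGeometry.ComplexMultiplication (IsCMTypeRealisation)
open Literature.AlgebraicTopology.SingularHomology
open Literature.NumberTheory.ComplexMultiplication
open Summit.HodgeConjecture.CorCM.Census.MultiFieldWeil

open scoped Classical

section OneField

variable {I : Type} {r : ℕ} {Kf : I → Type} [∀ i, Field (Kf i)] [∀ i, NumberField (Kf i)] [∀ i, IsCMField (Kf i)]
  {i₀ : I} {is : Fin r → I} {τ : Kf i₀ →+* ℂ}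
  {A : Fin (r + 1) → AbelianVariety ℂ} {Φ : ∀ j : Fin (r + 1), CMType (Kf (mfSlots i₀ is j))}
  {ι : ∀ j, 𝓞 (Kf (mfSlots i₀ is j)) →+* End (A j)}
  {θ : ∀ j, Kf (mfSlots i₀ is j) →+* Module.End ℂ (complexBetti (A j).X 1)}

/-- **ONE HYPERBOLIC `(3,3)`-SIXFOLD OVER ONE DODECIC CM FIELD THROUGH `k` WITH `3`-HOMOGENEOUS SEXTIC PART, TIMES THE CM CURVE — EVERY PRODUCT OF COPIES, GIVEN MARKMAN'S THEOREM
AND THE HYPERBOLICITY DATUM.**  See the module docstring.  `HC_CM` is NOT asserted. [cite: Markman2025SecantWeil, Thm 1.5.1 and §1.1] [cite: vanGeemen1994HodgeAV, 4.9, Lemma 5.2 (1)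
and 5.4] [cite: Shimura1998, §18.2 Lemma (i)] [cite: DixonMortimer1996, §2.1; §9.4] -/
theorem hodgeConjectureFor_biproduct_comp_of_dodecicHyperbolic_oneField (hM6 : Markman2025_weilClasses_algebraic_hyperbolicSixfold)
    {N : ℕ} (κ : Fin N → Fin (r + 1)) (h2 : Module.finrank ℚ (Kf i₀) = 2)
    (hdeg : ∀ m : Fin r, Module.finrank ℚ (Kf (is m)) = 12) (iK : ∀ i : I, Kf i₀ →+* Kf i)
    (hA : ∀ j, IsCMTypeRealisation (Φ j) (A j) (ι j) (θ j)) (hΨ : ∀ σ : Kf i₀ →+* ℂ, σ ∈ (Φ 0).1 ↔ σ = τ)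
    (δ : 𝓞 (Kf i₀)) (d : ℕ) (hd : 0 < d) (hδ : ((δ : Kf i₀)) ^ 2 = -(d : Kf i₀)) (hτ : τ (δ : Kf i₀) = Complex.I * (Real.sqrt d : ℂ))
    (h33 : ∀ m : Fin r, (Finset.univ.filter fun s : Kf (is m) →+* ℂ => s.comp (iK (is m)) = τ ∧ s ∈ (Φ m.succ).1).card = 3)
    (hfib : ∀ m : Fin r, (Finset.univ.filter fun m' : Fin r => is m' = is m).card ≤ 1)
    (hI : ∀ m m' : Fin r, is m' = is m)
    (h3T : ∀ (m : Fin r) (S S' : Finset (Kf (is m) →+* ℂ)), (∀ s ∈ S, s.comp (iK (is m)) = τ) → (∀ s ∈ S', s.comp (iK (is m)) = τ) → S.card = 3 → S'.card = 3 →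
      ∃ ρ : ℂ ≃+* ℂ, (ρ : ℂ →+* ℂ).comp τ = τ ∧ ∀ s ∈ S, (ρ : ℂ →+* ℂ).comp s ∈ S')
    (hhyp : ∀ m : Fin r, ∃ (eP : ProjectiveEmbedding (⨁ fun j : Fin 1 => A (partSlots 0 m j)).X) (a : complexBetti (projectiveSpace eP.n ℂ) 2),
      IsRationalClass a ∧ a ≠ 0 ∧ IsHyperbolicWeilType (⨁ fun j : Fin 1 => A (partSlots 0 m j))
        (biproduct.map fun j : Fin 1 => ι (partSlots 0 m j) (δfam (fun m => iK (is m)) δ (partSlots 0 m j))) 3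
        ((d : ℂ) • complexBetti.map eP.ι 2 a +
          complexBetti.map (biproduct.map fun j : Fin 1 => ι (partSlots 0 m j) (δfam (fun m => iK (is m)) δ (partSlots 0 m j))).hom.hom.hom 2
            (complexBetti.map eP.ι 2 a))) :
    HodgeConjectureFor (⨁ fun j => A (κ j)).dim (⨁ fun j => A (κ j)).X := by
  have hττ : ComplexEmbedding.conjugate τ ≠ τ := QuarticCM.conjugate_ne τ
  have hk : ∀ σ : Kf i₀ →+* ℂ, σ = τ ∨ σ = ComplexEmbedding.conjugate τ := fun σ => QuarticCM.eq_or_eq_conjugate_of_quadratic h2 τ σ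
  let im : ∀ m : Fin r, Kf i₀ →+* Kf (is m) := fun m => iK (is m)
  have hdeg' : ∀ m : Fin r, Module.finrank ℚ (Kf (is m)) = 2 * 6 := fun m => by rw [hdeg m]
  -- (1) the units (all singletons) and ONE SIGN FRAME PER INDEX
  obtain ⟨U, hU⟩ := exists_unitRep is
  have hfr : ∀ i : I, Module.finrank ℚ (Kf i) = 2 * 6 → ∃ E : (Kf i →+* ℂ) ≃ Fin 6 × Bool,
      (∀ s, (E s).2 = true ↔ s.comp (iK i) = τ) ∧ ∀ s, E (ComplexEmbedding.conjugate s) = ((E s).1, !(E s).2) := fun i hdi => exists_signFrame hdi h2 (iK i) hττ hk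
  choose E hE_sign hE_conj using hfr
  have diagT : ∀ i j : I, ∀ h : i = j, ∀ (hi : Module.finrank ℚ (Kf i) = 2 * 6) (hj : Module.finrank ℚ (Kf j) = 2 * 6) (ρ : ℂ →+* ℂ) (a x y : Fin 6),
      ρ.comp ((E i hi).symm (a, true)) = (E i hi).symm (x, true) → ρ.comp ((E j hj).symm (a, true)) = (E j hj).symm (y, true) → x = y := by
    intro i j h; subst h; intro hi hj ρ a x y h₁ h₂
    exact congrArg Prod.fst ((E i hi).symm.injective (h₁.symm.trans h₂))
  -- (2) the frames of the slots, their readings and position sets (all of size `6`)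
  let e : ∀ m : Fin r, (Kf (is m) →+* ℂ) ≃ Fin 6 × Bool := fun m => E (is m) (hdeg' m)
  have he_sign : ∀ (m : Fin r) (s : Kf (is m) →+* ℂ), (e m s).2 = true ↔ s.comp (im m) = τ := fun m => hE_sign (is m) (hdeg' m)
  have he_conj : ∀ (m : Fin r) (s : Kf (is m) →+* ℂ), e m (ComplexEmbedding.conjugate s) = ((e m s).1, !(e m s).2) := fun m => hE_conj (is m) (hdeg' m)
  let P : ∀ _ : Fin r, Finset (Fin 6) := fun m => Finset.univ.filter fun a : Fin 6 => (e m).symm (a, true) ∈ (Φ m.succ).1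
  have hΦ : ∀ (m : Fin r) (s : Kf (is m) →+* ℂ), s ∈ (Φ m.succ).1 ↔ (e m s).2 = decide ((e m s).1 ∈ P m) := fun m s =>
    mem_iff_snd_eq_decide_mem_posSet (he_conj m) (Φ m.succ) s
  have hcard : ∀ m : Fin r, (P m).card = 3 := fun m => (card_posSet (he_sign m) (Φ m.succ)).trans (h33 m)
  have hmemP : ∀ (m : Fin r) (a : Fin 6), a ∈ P m ↔ (e m).symm (a, true) ∈ (Φ m.succ).1 := fun m a => by
    simp only [P, Finset.mem_filter, Finset.mem_univ, true_and]
  have hsymm_sign : ∀ (m : Fin r) (a : Fin 6), ((e m).symm (a, true)).comp (im m) = τ := fun m a => (he_sign m _).1 (by simp)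
  -- (3) the realised tuples are DIAGONAL on every unit
  have hn : ∀ m m' : Fin r, U m' = U m → (6 : ℕ) = 6 := fun _ _ _ => rfl
  have hdg0 : ∀ π ∈ realisedTuples e τ, ∀ (m m' : Fin r), U m' = U m → ∀ a : Fin 6, π m' a = π m a := by
    intro π hπ m m' h a; obtain ⟨ρ, -, hρ⟩ := (mem_realisedTuples e τ π).1 hπ
    exact diagT _ _ ((hU m m').1 h) (hdeg' m') (hdeg' m) (ρ : ℂ →+* ℂ) a (π m' a) (π m a) (hρ m' a) (hρ m a)
  have hdg : ∀ π ∈ realisedTuples e τ, ∀ (m m' : Fin r) (h : U m' = U m) (a : Fin 6), Fin.cast (hn m m' h) (π m' a) = π m (Fin.cast (hn m m' h) a) := by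
    intro π hπ m m' h a
    have e1 : Fin.cast (hn m m' h) (π m' a) = π m' a := Fin.ext rfl
    have e2 : Fin.cast (hn m m' h) a = a := Fin.ext rfl
    rw [e1, e2]; exact hdg0 π hπ m m' h a
  -- (4) ONE field: no two units, so the cross-unit hypothesis is void
  have hstab : ∀ (m₀ m : Fin r), U m₀ ≠ U m → ∀ a a' : Fin 6, ∃ ν ∈ realisedTuples e τ, (∀ m', U m' = U m₀ → ν m' = 1) ∧ ν m a = a' :=
    fun m₀ m hne => absurd ((hU m m₀).2 (hI m m₀)) hne
  -- (5) the single-slot menu: `3`-HOMOGENEITY of the realised tuples on every slot, from `h3T`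
  have hhomR : ∀ (m : Fin r) (Q : Finset (Fin 6)), Q.card = 3 → ∃ π ∈ realisedTuples e τ, preG (π m) (P m) = Q := by
    intro m Q hQ
    have hinj : Function.Injective fun a : Fin 6 => (e m).symm (a, true) := fun a b h => congrArg Prod.fst ((e m).symm.injective h)
    obtain ⟨ρ, hρτ, hρS⟩ := h3T m (Q.image fun a : Fin 6 => (e m).symm (a, true)) ((P m).image fun a : Fin 6 => (e m).symm (a, true))
      (fun s hs => by obtain ⟨a, -, rfl⟩ := Finset.mem_image.1 hs; exact hsymm_sign m a)
      (fun s hs => by obtain ⟨a, -, rfl⟩ := Finset.mem_image.1 hs; exact hsymm_sign m a)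
      (by rw [Finset.card_image_of_injective _ hinj, hQ]) (by rw [Finset.card_image_of_injective _ hinj, hcard m])
    obtain ⟨π, hπ, hπρ⟩ := exists_mem_realisedTuples_of_comp_tau_eq (e := e) he_sign ρ hρτ
    have hinto : ∀ a ∈ Q, π m a ∈ P m := fun a ha => by
      have h1 : (ρ : ℂ →+* ℂ).comp ((e m).symm (a, true)) ∈ (P m).image fun b : Fin 6 => (e m).symm (b, true) := hρS _ (Finset.mem_image.2 ⟨a, ha, rfl⟩)
      rw [hπρ m a] at h1
      obtain ⟨b, hb, hbe⟩ := Finset.mem_image.1 h1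
      have hba : b = π m a := hinj hbe
      rw [← hba]; exact hb
    refine ⟨π, hπ, (Finset.eq_of_subset_of_card_le (fun a ha => mem_preG.2 (hinto a ha)) ?_).symm⟩
    rw [card_preG, hcard m, hQ]
  have hkind : ∀ m : Fin r, (∀ m', U m' = U m → m' = m) → (6 : ℕ).Prime ∨ (3 : ℕ) = 1 ∨
      ∀ Q : Finset (Fin 6), Q.card = 3 → ∃ π ∈ realisedTuples e τ, preG (π m) (P m) = Q := fun m _ => Or.inr (Or.inr (hhomR m))
  -- (6) no unit has two slots
  have hunit : ∀ m, (∃ m', m' ≠ m ∧ U m' = U m) → ∀ (u : {m' : Fin r // U m' = U m} → Fin 6 → ℤ) (w : ℤ),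
      (∀ π ∈ realisedTuples e τ, (∑ i, ∑ x : Fin 6, (if π m x ∈ (P i.1).image (Fin.cast (hn m i.1 i.2)) then u i x else -u i x)) = w) →
      ∀ (i : {m' : Fin r // U m' = U m}) (a b : Fin 6), u i a = u i b := by
    intro m hm
    exfalso
    obtain ⟨m', hne, hUm'⟩ := hm
    have him : is m' = is m := (hU m m').1 hUm'
    have hsub : ({m, m'} : Finset (Fin r)) ⊆ Finset.univ.filter fun y : Fin r => is y = is m := fun y hy => by
      simp only [Finset.mem_insert, Finset.mem_singleton] at hy
      simp only [Finset.mem_filter, Finset.mem_univ, true_and]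
      rcases hy with rfl | rfl
      exacts [rfl, him]
    have h2c := (Finset.card_le_card hsub).trans (hfib m)
    rw [Finset.card_pair hne.symm] at h2c
    omega
  -- (7) the engine with separated units; the single-slot Weil spaces from Markman's sixfold theorem and the hyperbolicity data
  exact hodgeConjectureFor_biproduct_comp_of_unitsSeparated_frames (is := is) (n := fun _ => 6) P (fun _ => 3) hcard (fun _ => by norm_num) (fun _ => by norm_num)
    κ h2 im hτ hA e he_sign he_conj hΨ hΦ U hn hdg hstab hunit hkind
    fun m => by
      obtain ⟨eP, a, ha, ha0, hh⟩ := hhyp m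
      exact weilHyp_of_markman_sixfold_hyperbolic hM6 m (hdeg m) hd hδ hA eP ha ha0 hh

/-- **Dominated form.** [cite: Markman2025SecantWeil, Thm 1.5.1] [cite: MumfordAV1970, §19 Thm. 1 and p. 169] -/
theorem hodgeConjectureFor_of_avDominatedBy_comp_of_dodecicHyperbolic_oneField (hM6 : Markman2025_weilClasses_algebraic_hyperbolicSixfold)
    {N : ℕ} (κ : Fin N → Fin (r + 1)) (h2 : Module.finrank ℚ (Kf i₀) = 2)
    (hdeg : ∀ m : Fin r, Module.finrank ℚ (Kf (is m)) = 12) (iK : ∀ i : I, Kf i₀ →+* Kf i)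
    (hA : ∀ j, IsCMTypeRealisation (Φ j) (A j) (ι j) (θ j)) (hΨ : ∀ σ : Kf i₀ →+* ℂ, σ ∈ (Φ 0).1 ↔ σ = τ)
    (δ : 𝓞 (Kf i₀)) (d : ℕ) (hd : 0 < d) (hδ : ((δ : Kf i₀)) ^ 2 = -(d : Kf i₀)) (hτ : τ (δ : Kf i₀) = Complex.I * (Real.sqrt d : ℂ))
    (h33 : ∀ m : Fin r, (Finset.univ.filter fun s : Kf (is m) →+* ℂ => s.comp (iK (is m)) = τ ∧ s ∈ (Φ m.succ).1).card = 3)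
    (hfib : ∀ m : Fin r, (Finset.univ.filter fun m' : Fin r => is m' = is m).card ≤ 1)
    (hI : ∀ m m' : Fin r, is m' = is m)
    (h3T : ∀ (m : Fin r) (S S' : Finset (Kf (is m) →+* ℂ)), (∀ s ∈ S, s.comp (iK (is m)) = τ) → (∀ s ∈ S', s.comp (iK (is m)) = τ) → S.card = 3 → S'.card = 3 →
      ∃ ρ : ℂ ≃+* ℂ, (ρ : ℂ →+* ℂ).comp τ = τ ∧ ∀ s ∈ S, (ρ : ℂ →+* ℂ).comp s ∈ S')
    (hhyp : ∀ m : Fin r, ∃ (eP : ProjectiveEmbedding (⨁ fun j : Fin 1 => A (partSlots 0 m j)).X) (a : complexBetti (projectiveSpace eP.n ℂ) 2),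
      IsRationalClass a ∧ a ≠ 0 ∧ IsHyperbolicWeilType (⨁ fun j : Fin 1 => A (partSlots 0 m j))
        (biproduct.map fun j : Fin 1 => ι (partSlots 0 m j) (δfam (fun m => iK (is m)) δ (partSlots 0 m j))) 3
        ((d : ℂ) • complexBetti.map eP.ι 2 a +
          complexBetti.map (biproduct.map fun j : Fin 1 => ι (partSlots 0 m j) (δfam (fun m => iK (is m)) δ (partSlots 0 m j))).hom.hom.hom 2
            (complexBetti.map eP.ι 2 a)))
    {X : AbelianVariety ℂ} (hX : Domination.AVDominatedBy X (⨁ fun j => A (κ j))) : HodgeConjectureFor X.dim X.X :=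
  Domination.hodgeConjectureFor_of_avDominatedBy
    (hodgeConjectureFor_biproduct_comp_of_dodecicHyperbolic_oneField hM6 κ h2 hdeg iK hA hΨ δ d hd hδ hτ h33 hfib hI h3T hhyp) hX

end OneField

end Summit.HodgeConjecture.CorCM.MultiFieldWeil

end
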